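import Summits.BirchSwinnertonDyer.BirchSwinnertonDyer.Theorems.SignedLowerHalvesSmallImageLowerHalfBothSignsRttCharRoadE1LocalSquareKummer
import Summits.BirchSwinnertonDyer.Rank1Residual.Additive.BaseChangeSubgroupH1
import HarnessLib

/-!
# Route `SignedLowerHalves`, crux L `SmallImageLowerHalfBothSigns` (stmt-BirchSwinnertonDyer-23599), line `rtt_w3` v11 — brick D3-W, the Kummer
# witness ACROSS `BaseChange.subgroupH1Iso` (memo `Lines/rtt_w3-MEMO-D3c-w3g17.md` §8, glue steps (2)+(3)): the `k`-side class
# `subgroupH1Iso [φ_K]` of a `K`-side cocycle `φ_K ∈ Z¹(U^K, E_K[p^∞])` (`U ≤ galRange K`, `U^K = res⁻¹U`; cell bsd-potss's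
# `Rank1Residual/Additive/BaseChangeSubgroupH1`) is the class of the explicit pullback `ξ₀ = (ι_p)⁻¹ ∘ φ_K ∘ subgroupToComap`, and if `φ_K` has the
# Kummer witness `Q_K` on the `K`-side local group at `ι'`, then `ξ₀` has the Kummer witness `transportPoints Q_K` on `localSubgroupOfEmb U ι`
# (p765761 with `Θ := subgroupToComap`) — the INPUT of `…E1LocalCoresBridge.corH1_resH1Hom_mem_localKummerOverOfEmb_signed` for
# `U = κ.layerSubgroup n ⊓ galRange K`.

Width seat `bsd-line-slh-p3-w3` g17 under LEAD `cruxlead-stmt-BirchSwinnertonDyer-23599` (cell `bsd-ssimc`; `--supports stmt-BirchSwinnertonDyer-23599 --as helper`).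
THEOREMS ONLY (no definition, no named fact, no instance, no `sorry`). BSD / crux L / INJ are NOT proved here.

* `subgroupH1Iso_oneCocycleClass` — `subgroupH1Iso [φ_K] = [subgroupToComap^* φ_K]` (`subgroupH1Iso_apply` + `map_oneCocycleClass`).
* ★ `pointsMapOfEmb_pullback_subgroupToComap` — the pullback's local crossed homomorphism on `localSubgroupOfEmb U ι` is `τ ↦ τQ − Q`,
  `Q = transportPoints Q_K`, when `φ_K`'s on `localSubgroupOfEmb U^K ι'` is `τ' ↦ τ'Q_K − Q_K`.
* ★★ `exists_cocycle_subgroupH1Iso_kummer` — packaged: `∃ ξ₀, subgroupH1Iso [φ_K] = [ξ₀] ∧ (p^a kills ξ₀'s values if it kills φ_K's) ∧ Kummer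
  witness `transportPoints Q_K` in the OUTPUT form of p765761`.

References: [SerreGaloisCohomology1997] I §2.4, II §1.1; [Kobayashi2003] Def. 1.1.
-/

set_option autoImplicit false
set_option linter.dupNamespace false -- D-0017: single-problem summit, the namespace repeats the problem name by design
noncomputable section

open scoped Classical

universe u

namespace Summit.BirchSwinnertonDyer.BirchSwinnertonDyer.Theorems.SmallImageCharSignedSelmer

open Literature.NumberTheory.EllipticCurves Literature.NumberTheory.GaloisRepresentations Field
  Summit.BirchSwinnertonDyer.Rank1Residual.Additive.LocalTransport Summit.BirchSwinnertonDyer.Rank1Residual.Additive.BaseChange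

section Iso

variable {k : Type u} [Field k] (K : Type u) [Field K] [Algebra k K] [Algebra.IsAlgebraic k K] [PerfectField K]
  {U : Subgroup (absoluteGaloisGroup k)} (hU : U ≤ galRange (K := k) K)
  {E : Type u} [Field E] [Algebra k E] {E' : Type u} [Field E'] [Algebra K E'] [Algebra k E'] [IsScalarTower k K E']
  (ι : AlgebraicClosure k →ₐ[k] AlgebraicClosure E) (ι₂ : AlgebraicClosure E ≃+* AlgebraicClosure E')
  (ι' : AlgebraicClosure K →ₐ[K] AlgebraicClosure E')
  (hcompat : ∀ z : AlgebraicClosure k, ι' (closureEmb (K := k) K z) = ι₂ (ι z))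
  (hfixU : ∀ h : absoluteGaloisGroup E, resGalOfEmb ι h ∈ galRange (K := k) K → ∀ y : E',
    (show AlgebraicClosure E ≃ₐ[E] AlgebraicClosure E from h) (ι₂.symm (algebraMap E' (AlgebraicClosure E') y)) =
      ι₂.symm (algebraMap E' (AlgebraicClosure E') y))
  (W : WeierstrassCurve k) (p : ℕ)

omit [Algebra k E'] [IsScalarTower k K E'] in
/-- **`subgroupH1Iso [φ_K] = [subgroupToComap^* φ_K]`**: the base-change isomorphism on an explicit class is the class of the explicit pullback
`τ ↦ (E[p^∞] ≃ E_K[p^∞])⁻¹ (φ_K (res⁻¹ τ))`. [cite: SerreGaloisCohomology1997, I §2.4] -/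
theorem subgroupH1Iso_oneCocycleClass (φ_K : contOneCocycles (discreteTopRep (comapResGal K U) ((W.baseChange K).geomPrimaryTorsion p))) :
    subgroupH1Iso K W p hU (oneCocycleClass (discreteTopRep (comapResGal K U) ((W.baseChange K).geomPrimaryTorsion p)) φ_K) =
      oneCocycleClass (discreteTopRep U (W.geomPrimaryTorsion p)) (contOneCocycles.pullback (subgroupToComap K hU)
        (resHomOfEquivariant (subgroupToComap K hU) (primaryBaseChangeEquiv K W p).symm.toAddMonoidHom
          (primaryBaseChangeEquiv_symm_subgroupToComap_smul K W p hU)) φ_K) := by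
  rw [subgroupH1Iso_apply]
  exact map_oneCocycleClass (X := discreteTopRep (comapResGal K U) ((W.baseChange K).geomPrimaryTorsion p))
    (Y := discreteTopRep U (W.geomPrimaryTorsion p)) (subgroupToComap K hU)
    (resHomOfEquivariant (subgroupToComap K hU) (primaryBaseChangeEquiv K W p).symm.toAddMonoidHom
      (primaryBaseChangeEquiv_symm_subgroupToComap_smul K W p hU)) φ_K

omit [Algebra k E'] [IsScalarTower k K E'] in
/-- `m` kills the values of the pullback when it kills those of `φ_K`. [folklore] -/
theorem nsmul_pullback_subgroupToComap_apply_eq_zero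
    (φ_K : contOneCocycles (discreteTopRep (comapResGal K U) ((W.baseChange K).geomPrimaryTorsion p))) {m : ℕ}
    (hm : ∀ x, m • φ_K.1 x = 0) (τ : U) :
    m • (contOneCocycles.pullback (subgroupToComap K hU)
        (resHomOfEquivariant (subgroupToComap K hU) (primaryBaseChangeEquiv K W p).symm.toAddMonoidHom
          (primaryBaseChangeEquiv_symm_subgroupToComap_smul K W p hU)) φ_K).1 τ = 0 := by
  rw [contOneCocycles.pullback_apply]
  change m • (primaryBaseChangeEquiv K W p).symm.toAddMonoidHom (φ_K.1 (subgroupToComap K hU τ)) = 0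
  rw [← map_nsmul, hm, map_zero]

include hfixU in
/-- ★ **The Kummer witness crosses `subgroupH1Iso`.** If `φ_K ∈ Z¹(U^K, E_K[p^∞])` has local crossed homomorphism `τ' ↦ τ'Q_K − Q_K` on
`localSubgroupOfEmb U^K ι'`, then the pullback `subgroupToComap^* φ_K ∈ Z¹(U, E[p^∞])` has local crossed homomorphism `τ ↦ τQ − Q` on
`localSubgroupOfEmb U ι` with `Q = transportPoints Q_K` (p765761 `pointsMapOfEmb_eq_smul_transportPoints_sub` with `Θ := subgroupToComap`,
`hΘ := resGal_subgroupToComap`, `hFF` by `apply_symm_apply`). [cite: SerreGaloisCohomology1997, I §2.4, II §1.1] [cite: Kobayashi2003, Def. 1.1] -/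
theorem pointsMapOfEmb_pullback_subgroupToComap
    (φ_K : contOneCocycles (discreteTopRep (comapResGal K U) ((W.baseChange K).geomPrimaryTorsion p)))
    (Q_K : localPoints (W.baseChange K) E')
    (hQ : ∀ τ' : localSubgroupOfEmb (comapResGal K U) ι',
      pointsMapOfEmb (W.baseChange K) ι' ((φ_K.1 (resGalSubgroupOfEmb (comapResGal K U) ι' τ') :
        (W.baseChange K).geomPrimaryTorsion p) : (W.baseChange K).geomPoints) = (τ' : absoluteGaloisGroup E') • Q_K - Q_K)
    (τ : localSubgroupOfEmb U ι) :
    pointsMapOfEmb W ι (((contOneCocycles.pullback (subgroupToComap K hU)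
        (resHomOfEquivariant (subgroupToComap K hU) (primaryBaseChangeEquiv K W p).symm.toAddMonoidHom
          (primaryBaseChangeEquiv_symm_subgroupToComap_smul K W p hU)) φ_K).1 (resGalSubgroupOfEmb U ι τ) : W.geomPrimaryTorsion p) :
        W.geomPoints) =
      (τ : absoluteGaloisGroup E) • transportPoints K ι ι₂ ι' hcompat W Q_K - transportPoints K ι ι₂ ι' hcompat W Q_K :=
  pointsMapOfEmb_eq_smul_transportPoints_sub K U (comapResGal K U) (fun _ h ↦ h) ι ι₂ ι' hcompat (fun h hh ↦ hfixU h (hU hh))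
    (subgroupToComap K hU) (resGal_subgroupToComap K hU) W p
    (fun x ↦ (contOneCocycles.pullback (subgroupToComap K hU)
        (resHomOfEquivariant (subgroupToComap K hU) (primaryBaseChangeEquiv K W p).symm.toAddMonoidHom
          (primaryBaseChangeEquiv_symm_subgroupToComap_smul K W p hU)) φ_K).1 x)
    (fun y ↦ φ_K.1 y) (fun x ↦ by
      rw [contOneCocycles.pullback_apply]
      exact ((primaryBaseChangeEquiv K W p).apply_symm_apply _).symm) Q_K hQ τ

include hfixU in
/-- ★★ **Packaged for the glue** (`U = κ.layerSubgroup n ⊓ galRange K`): from a `K`-side cocycle `φ_K` killed by `p^a` with Kummer witness `Q_K`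
at `ι'`, a `k`-side cocycle `ξ₀` on `↥U` with `subgroupH1Iso [φ_K] = [ξ₀]`, killed by `p^a`, whose local crossed homomorphism on
`localSubgroupOfEmb U ι` is the Kummer cocycle of `transportPoints Q_K` — the input of `…E1LocalCoresBridge.corH1_resH1Hom_mem_localKummerOverOfEmb_signed`.
[cite: SerreGaloisCohomology1997, I §2.4, II §1.1] [cite: Kobayashi2003, Def. 1.1] -/
theorem exists_cocycle_subgroupH1Iso_kummer
    (φ_K : contOneCocycles (discreteTopRep (comapResGal K U) ((W.baseChange K).geomPrimaryTorsion p))) {a : ℕ}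
    (ha : ∀ x, p ^ a • φ_K.1 x = 0) (Q_K : localPoints (W.baseChange K) E')
    (hQ : ∀ τ' : localSubgroupOfEmb (comapResGal K U) ι',
      pointsMapOfEmb (W.baseChange K) ι' ((φ_K.1 (resGalSubgroupOfEmb (comapResGal K U) ι' τ') :
        (W.baseChange K).geomPrimaryTorsion p) : (W.baseChange K).geomPoints) = (τ' : absoluteGaloisGroup E') • Q_K - Q_K) :
    ∃ ξ₀ : contOneCocycles (discreteTopRep U (W.geomPrimaryTorsion p)),
      subgroupH1Iso K W p hU (oneCocycleClass (discreteTopRep (comapResGal K U) ((W.baseChange K).geomPrimaryTorsion p)) φ_K) =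
          oneCocycleClass (discreteTopRep U (W.geomPrimaryTorsion p)) ξ₀ ∧
        (∀ x, p ^ a • ξ₀.1 x = 0) ∧
        ∀ τ : localSubgroupOfEmb U ι,
          pointsMapOfEmb W ι ((ξ₀.1 (resGalSubgroupOfEmb U ι τ) : W.geomPrimaryTorsion p) : W.geomPoints) =
            (τ : absoluteGaloisGroup E) • transportPoints K ι ι₂ ι' hcompat W Q_K - transportPoints K ι ι₂ ι' hcompat W Q_K :=
  ⟨_, subgroupH1Iso_oneCocycleClass K hU W p φ_K, nsmul_pullback_subgroupToComap_apply_eq_zero K hU W p φ_K ha,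
    pointsMapOfEmb_pullback_subgroupToComap K hU ι ι₂ ι' hcompat hfixU W p φ_K Q_K hQ⟩

end Iso

end Summit.BirchSwinnertonDyer.BirchSwinnertonDyer.Theorems.SmallImageCharSignedSelmer

end
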